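import Mathlib.RingTheory.Etale.Kaehler
import Mathlib.RingTheory.Derivation.Basic
import Mathlib.Algebra.MvPolynomial.PDeriv
import Mathlib.FieldTheory.IntermediateField.Adjoin.Basic
import Mathlib.LinearAlgebra.Basis.VectorSpace
import Mathlib.LinearAlgebra.Matrix.NonsingularInverse
import Mathlib.LinearAlgebra.Dimension.Constructions
import Mathlib.LinearAlgebra.FiniteDimensional.Lemmas
import Literature.NumberTheory.Transcendental.AxDerivationTools
import Literature.NumberTheory.Transcendental.EclPregeometryProofs
import HarnessLib

/-!
# Derivations of finitely generated field extensions and Kirby's Khovanskii dichotomy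

Trunk T-TRANSCEND (`Literature/NumberTheory/Transcendental`). Support for the proof of Kirby's
weak Schanuel property (J. Kirby, *Exponential algebraicity in exponential fields*, Bull. Lond.
Math. Soc. 42 (2010), Thm. 1.2; named facts `Literature.NumberTheory.Transcendental.Kirby2010_weakSchanuel`,
`Literature.NumberTheory.Transcendental.kirby_weakSchanuel_ecl_empty`). Everything here is PROVED:

* `Literature.NumberTheory.Transcendental.exists_derivation_of_aeval` — **Lang's criterion** for derivations of a finitely
  generated field extension `L = F(z₁, …, z_k)`, in the case of derivations trivial on `F`:
  prescribed values `D zₛ = wₛ` come from an `F`-derivation `D : L → L` as soon as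
  `∑ₛ (∂g/∂Xₛ)(z) · wₛ = 0` for every polynomial relation `g(z) = 0`, `g ∈ F[X]`
  (S. Lang, *Algebra*, Ch. VIII §5; the derivation is first defined on `F[X]`, descends to
  `F[z] = F[X]/𝔭` and extends to the fraction field `L`, `Literature.NumberTheory.Transcendental.exists_derivation_extend_of_isFractionRing`).
* `Literature.NumberTheory.Transcendental.khovanskii_dichotomy` — the dichotomy behind Kirby 2010, Lemma 4.8 and the proof of
  Prop. 7.1: for a field `L = F(x̄, ȳ)` generated by `2n` elements, EITHER `(x̄, ȳ)` is a
  non-degenerate zero of `n` polynomials `g₁, …, gₙ ∈ F[X̄, Ȳ]` for the "exponential Jacobian"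
  `det ((∂gᵢ/∂Xⱼ + Yⱼ ∂gᵢ/∂Yⱼ)(x̄, ȳ)) ≠ 0` (a Khovanskii system, when `ȳ = exp x̄`), OR there is
  an `F`-derivation `D` of `L` with `D yᵢ = yᵢ D xᵢ` for all `i` (an "E-derivation" for the
  partial exponential `xᵢ ↦ yᵢ`) and `D xⱼ ≠ 0` for some `j`. (Kirby phrases this through the
  module `Ξ(F/C)` of E-differentials, Lemma 4.8: "generated by `{da₁, …, daₙ}` with relations
  `∑ⱼ (∂f/∂Xⱼ) daⱼ + (∂f/∂Yⱼ) e^{aⱼ} daⱼ = 0`"; `Ξ = 0` iff a Khovanskii system exists.)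

## References

* J. Kirby, *Exponential algebraicity in exponential fields*, Bull. Lond. Math. Soc. 42 (2010),
  879–890, arXiv:0810.4285: Lemma 4.6, Lemma 4.8, proof of Prop. 7.1.
* S. Lang, *Algebra*, 3rd ed., GTM 211, Springer (2002), Ch. VIII §5 (Derivations).
-/

noncomputable section

open MvPolynomial

namespace Literature.NumberTheory.Transcendental

/-! ### Lang's criterion: derivations of `F(z)` trivial on `F` with prescribed values on `z` -/

section LangCriterion

variable {F L σ : Type*} [Field F] [Field L] [Algebra F L] [Fintype σ]

/-- **Lang's criterion** (derivations of a finitely generated field extension, the case of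
derivations vanishing on the base field). Let `L = F(z)` be generated over `F` by a finite
family `z : σ → L` and let `w : σ → L`. If `∑ₛ (∂g/∂Xₛ)(z) · wₛ = 0` for every `g ∈ F[Xₛ : s ∈ σ]`
with `g(z) = 0`, then there is an `F`-derivation `D : L → L` with `D zₛ = wₛ` for all `s`.
Proof: `D₀ g = ∑ₛ (∂g/∂Xₛ)(z) wₛ` is `F`-linear with `D₀(gh) = g(z) D₀h + h(z) D₀g`, and vanishes
on the kernel of `F[X] → F[z]`, so descends to an `F`-derivation `F[z] → L`, which extends to
`L = Frac F[z]` (`exists_derivation_extend_of_isFractionRing`). (S. Lang, *Algebra*, Ch. VIII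
§5, the criterion for extending a derivation to `k(x) = k(x₁, …, xₙ)`.)
[cite: Lang2002, Ch. VIII §5] -/
theorem exists_derivation_of_aeval (z : σ → L)
    (htop : IntermediateField.adjoin F (Set.range z) = ⊤) (w : σ → L)
    (hw : ∀ g : MvPolynomial σ F, aeval z g = 0 → ∑ s, aeval z (pderiv s g) * w s = 0) :
    ∃ D : Derivation F L L, ∀ s, D (z s) = w s := by
  classical
  -- the candidate derivation on polynomials `D₀ g = ∑ₛ (∂g/∂Xₛ)(z) wₛ`
  let D₀ : MvPolynomial σ F → L := fun g => ∑ s, aeval z (pderiv s g) * w s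
  have hD₀ : ∀ g, D₀ g = ∑ s, aeval z (pderiv s g) * w s := fun _ => rfl
  have hadd : ∀ g h, D₀ (g + h) = D₀ g + D₀ h := fun g h => by
    simp only [hD₀, map_add, add_mul, Finset.sum_add_distrib]
  have hsmul : ∀ (c : F) g, D₀ (c • g) = c • D₀ g := fun c g => by
    simp only [hD₀, Finset.smul_sum]
    refine Finset.sum_congr rfl fun s _ => ?_
    rw [Derivation.map_smul, map_smul, smul_mul_assoc]
  have hsub : ∀ g h, D₀ (g - h) = D₀ g - D₀ h := fun g h => by
    simp only [hD₀, map_sub, sub_mul, Finset.sum_sub_distrib]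
  have hmul : ∀ g h, D₀ (g * h) = aeval z g * D₀ h + aeval z h * D₀ g := fun g h => by
    simp only [hD₀, Derivation.leibniz, smul_eq_mul, map_add, map_mul, add_mul,
      Finset.sum_add_distrib, Finset.mul_sum, mul_assoc]
  have hX : ∀ s, D₀ (X s) = w s := fun s => by
    simp only [hD₀, pderiv_X]
    rw [Finset.sum_eq_single s]
    · simp [Pi.single_eq_same]
    · intro t _ hts
      simp [Pi.single_eq_of_ne hts.symm]
    · intro hs; exact absurd (Finset.mem_univ s) hs
  have hone : D₀ 1 = 0 := by simp [hD₀]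
  -- the range of evaluation and the descent of `D₀`
  set A : Subalgebra F L := (aeval z : MvPolynomial σ F →ₐ[F] L).range with hA
  have hwd : ∀ g h : MvPolynomial σ F, aeval z g = aeval z h → D₀ g = D₀ h := by
    intro g h hgh
    rw [← sub_eq_zero, ← hsub]
    exact hw _ (by rw [map_sub, hgh, sub_self])
  have hmem : ∀ a : A, ∃ g : MvPolynomial σ F, aeval z g = a := fun a => (AlgHom.mem_range _).mp a.2
  choose lift hlift using hmem
  have hval : ∀ (a : A) (g : MvPolynomial σ F), aeval z g = a → D₀ (lift a) = D₀ g :=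
    fun a g hg => hwd _ _ (by rw [hlift, hg])
  let DA : Derivation F A L :=
    { toFun := fun a => D₀ (lift a)
      map_add' := fun a b => by
        have h : aeval z (lift a + lift b) = (a + b : A) := by
          rw [map_add, hlift, hlift]; rfl
        rw [hval _ _ h, hadd]
      map_smul' := fun c a => by
        have h : aeval z (c • lift a) = (c • a : A) := by
          rw [map_smul, hlift]; rfl
        rw [hval _ _ h, hsmul, RingHom.id_apply]
      map_one_eq_zero' := by
        have h : aeval z (1 : MvPolynomial σ F) = (1 : A) := by rw [map_one]; rfl
        show D₀ (lift 1) = 0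
        rw [hval _ _ h, hone]
      leibniz' := fun a b => by
        have h : aeval z (lift a * lift b) = (a * b : A) := by
          rw [map_mul, hlift, hlift]; rfl
        show D₀ (lift (a * b)) = a • D₀ (lift b) + b • D₀ (lift a)
        rw [hval _ _ h, hmul, hlift, hlift, Subalgebra.smul_def, Subalgebra.smul_def,
          smul_eq_mul, smul_eq_mul] }
  have hDA : ∀ (a : A) (g : MvPolynomial σ F), aeval z g = a → DA a = D₀ g :=
    fun a g hg => hval a g hg
  -- `L` is the fraction field of `A = F[z]`
  have hAeq : Algebra.adjoin F (Set.range z) = A := Algebra.adjoin_range_eq_range_aeval F z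
  haveI : IsFractionRing A L := by
    refine IsFractionRing.of_field A L fun t => ?_
    have ht : t ∈ IntermediateField.adjoin F (Set.range z) := by rw [htop]; trivial
    obtain ⟨r, hr, s, hs, hts⟩ := IntermediateField.mem_adjoin_iff_div.mp ht
    rw [hAeq] at hr hs
    exact ⟨⟨r, hr⟩, ⟨s, hs⟩, hts⟩
  obtain ⟨D, hD⟩ := exists_derivation_extend_of_isFractionRing (R := F) DA
  refine ⟨D, fun s => ?_⟩
  have hzs : z s ∈ A := ⟨X s, aeval_X z s⟩
  have h1 : D (z s) = DA ⟨z s, hzs⟩ := hD ⟨z s, hzs⟩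
  rw [h1, hDA ⟨z s, hzs⟩ (X s) (aeval_X z s), hX]

end LangCriterion

/-! ### The Khovanskii dichotomy -/

section Dichotomy

variable {F L : Type*} [Field F] [Field L] [Algebra F L] {n : ℕ}

/-- Evaluation of the exponential partial derivative `∂g/∂Xⱼ + Yⱼ ∂g/∂Yⱼ` at `(x̄, ȳ)` in terms
of ordinary partial derivatives. [cite: Kirby2010, Lemma 4.6] -/
theorem aeval_ePD (x y : Fin n → L) (j : Fin n) (g : MvPolynomial (Fin n ⊕ Fin n) F) :
    aeval (Sum.elim x y) (Khovanskii.ePD j g) =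
      aeval (Sum.elim x y) (pderiv (Sum.inl j) g) +
        y j * aeval (Sum.elim x y) (pderiv (Sum.inr j) g) := by
  simp [Khovanskii.ePD]

/-- The sum `∑ₛ (∂g/∂Xₛ)(x̄, ȳ) wₛ` for the values `w = (μ, ȳ·μ)` of a would-be E-derivation is
`∑ⱼ (∂g/∂Xⱼ + Yⱼ ∂g/∂Yⱼ)(x̄, ȳ) μⱼ`. [cite: Kirby2010, Lemma 4.6] -/
theorem sum_aeval_pderiv_mul_eq (x y μ : Fin n → L) (g : MvPolynomial (Fin n ⊕ Fin n) F) :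
    ∑ s, aeval (Sum.elim x y) (pderiv s g) * Sum.elim μ (fun j => y j * μ j) s =
      ∑ j, aeval (Sum.elim x y) (Khovanskii.ePD j g) * μ j := by
  rw [Fintype.sum_sum_type, ← Finset.sum_add_distrib]
  refine Finset.sum_congr rfl fun j _ => ?_
  simp only [Sum.elim_inl, Sum.elim_inr, aeval_ePD]
  ring

/-- **The Khovanskii dichotomy** (Kirby 2010, Lemma 4.8 and proof of Prop. 7.1, made explicit).
Let `L = F(x̄, ȳ)` be generated over `F` by `x, y : Fin n → L`. Then either
(a) there are `g₁, …, gₙ ∈ F[X̄, Ȳ]` vanishing at `(x̄, ȳ)` with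
`det ((∂gᵢ/∂Xⱼ + Yⱼ ∂gᵢ/∂Yⱼ)(x̄, ȳ))ᵢⱼ ≠ 0` (so that, when `ȳ = exp x̄`, `x̄` solves a Khovanskii
system over `F`), or
(b) there is an `F`-derivation `D` of `L` with `D yᵢ = yᵢ · D xᵢ` for all `i` and `D xⱼ ≠ 0` for
some `j`.
Proof: let `W ≤ Lⁿ` be the `L`-span of the vectors `((∂g/∂Xⱼ + Yⱼ∂g/∂Yⱼ)(x̄, ȳ))ⱼ` over all
relations `g(x̄, ȳ) = 0`. If `W = Lⁿ`, `n` of these vectors form a basis: case (a). Otherwise a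
non-zero functional `μ` vanishing on `W` satisfies Lang's criterion for the values
`D xⱼ = μⱼ`, `D yⱼ = yⱼ μⱼ`: case (b). [cite: Kirby2010, Lemma 4.8] -/
theorem khovanskii_dichotomy (x y : Fin n → L)
    (htop : IntermediateField.adjoin F (Set.range x ∪ Set.range y) = ⊤) :
    (∃ g : Fin n → MvPolynomial (Fin n ⊕ Fin n) F,
        (∀ i, aeval (Sum.elim x y) (g i) = 0) ∧
        (Matrix.of fun i j => aeval (Sum.elim x y) (Khovanskii.ePD j (g i))).det ≠ 0) ∨
    ∃ D : Derivation F L L, (∀ i, D (y i) = y i * D (x i)) ∧ ∃ j, D (x j) ≠ 0 := by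
  classical
  set z : Fin n ⊕ Fin n → L := Sum.elim x y with hz
  have htop' : IntermediateField.adjoin F (Set.range z) = ⊤ := by rwa [hz, Set.Sum.elim_range]
  -- relations and their exponential gradients
  set P : Set (MvPolynomial (Fin n ⊕ Fin n) F) := {g | aeval z g = 0} with hP
  set v : P → Fin n → L := fun g j => aeval z (Khovanskii.ePD j g.1) with hv
  set W : Submodule L (Fin n → L) := Submodule.span L (Set.range v) with hW
  by_cases hWtop : W = ⊤
  · -- (a): a basis among the gradients
    left
    obtain ⟨b, hbsub, hbspan, hbli⟩ := exists_linearIndependent L (Set.range v)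
    have hbfin : b.Finite := hbli.setFinite
    haveI : Fintype b := hbfin.fintype
    have hcard : Fintype.card b = n := by
      have h1 : Module.finrank L (Submodule.span L b) = b.toFinset.card :=
        finrank_span_set_eq_card (R := L) (show LinearIndepOn L id b from hbli)
      rw [hbspan, ← hW, hWtop, finrank_top, Module.finrank_fin_fun, Set.toFinset_card] at h1
      exact h1.symm
    set e : b ≃ Fin n := Fintype.equivFinOfCardEq hcard with he
    have hrow : ∀ i : Fin n, ∃ g : P, v g = (e.symm i).1 := fun i => hbsub (e.symm i).2
    choose g hg using hrow
    refine ⟨fun i => (g i).1, fun i => (g i).2, ?_⟩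
    have hM : (Matrix.of fun i j => aeval z (Khovanskii.ePD j (g i).1)) =
        fun i => ((e.symm i : b) : Fin n → L) := by
      ext i j
      rw [Matrix.of_apply, ← hg i]
    have hli : LinearIndependent L fun i => ((e.symm i : b) : Fin n → L) :=
      hbli.comp e.symm e.symm.injective
    have hU : IsUnit (Matrix.of fun i j => aeval z (Khovanskii.ePD j (g i).1)) := by
      apply Matrix.linearIndependent_rows_iff_isUnit.mp
      change LinearIndependent L fun i => (Matrix.of fun i j => aeval z (Khovanskii.ePD j (g i).1)) i
      rw [hM]
      exact hli
    exact ((Matrix.isUnit_iff_isUnit_det _).mp hU).ne_zero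
  · -- (b): a functional vanishing on `W`
    right
    obtain ⟨f, hf0, hle⟩ := Submodule.exists_le_ker_of_lt_top W (lt_top_iff_ne_top.mpr hWtop)
    set μ : Fin n → L := fun j => f fun k => if j = k then 1 else 0 with hμ
    have hf : ∀ u : Fin n → L, f u = ∑ j, u j * μ j := fun u => by
      rw [LinearMap.pi_apply_eq_sum_univ f u]
      simp only [smul_eq_mul, hμ]
    have hμ0 : ∃ j, μ j ≠ 0 := by
      by_contra h
      push Not at h
      apply hf0
      refine LinearMap.ext fun u => ?_
      rw [hf u, LinearMap.zero_apply]
      exact Finset.sum_eq_zero fun j _ => by rw [h j, mul_zero]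
    have hw : ∀ g : MvPolynomial (Fin n ⊕ Fin n) F, aeval z g = 0 →
        ∑ s, aeval z (pderiv s g) * Sum.elim μ (fun j => y j * μ j) s = 0 := by
      intro g hg
      rw [hz, sum_aeval_pderiv_mul_eq, ← hz]
      have hmem : v ⟨g, hg⟩ ∈ W := Submodule.subset_span (Set.mem_range_self _)
      have := hle hmem
      rw [LinearMap.mem_ker, hf] at this
      exact this
    obtain ⟨D, hD⟩ := exists_derivation_of_aeval z htop' _ hw
    refine ⟨D, fun i => ?_, ?_⟩
    · have h1 := hD (Sum.inr i)
      have h2 := hD (Sum.inl i)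
      simp only [hz, Sum.elim_inr, Sum.elim_inl] at h1 h2
      rw [h1, h2]
    · obtain ⟨j, hj⟩ := hμ0
      refine ⟨j, ?_⟩
      have h2 := hD (Sum.inl j)
      simp only [hz, Sum.elim_inl] at h2
      rwa [h2]

end Dichotomy

end Literature.NumberTheory.Transcendental
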